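import Summits.HubbardSuperconductivity.HubbardSuperconductivity.Theorems.AnisotropyChordTowerXYAnchor
import Summits.HubbardSuperconductivity.HubbardSuperconductivity.Theorems.AnisotropyChordTransferLevelOne
import Summits.HubbardSuperconductivity.HubbardSuperconductivity.Theorems.AnisotropyChordTransferTolerance
import Literature.MathematicalPhysics.QuantumLattice.XXZAntiferromagnetGroundStateOrder

/-!
# Route `AnisotropyChord` / H0 rotor rung, route (1): THE HALF-FILLING ANCHOR (H1) IS A THEOREM FOR REPULSIVE HARD-CORE BOSONS,
# `−0.15 ≤ Δ ≤ 0` (prover seat `hubbard-h0-rotor-p1` g15; inputs: the tree's Kubo–Kishi / Wischmann–Müller-Hartmann planar window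
# `hardCoreBoson_ground_planar_spinHalf_x` and THEOREM Z⁺ `groundState_unique_of_even`)

THEOREM T and all its descendants (`…CompressibilityKR`, `…GapInvV`, `…Tolerance`, `…ResponseLink`) take the half-filling anchor
(H1) `HalfFillingAnchor Δ c₀` as a hypothesis, discharged so far only at the XY point (`halfFillingAnchor_xy`, Kennedy–Lieb–Shastry).
The Literature holds the certified planar window of the spin-½ XXZ model in the route's own frame,
`hardCoreBoson_ground_planar_spinHalf_x : −0.15 ≤ Δ ≤ 0 → HasEvenTorusLRO (Re ω₀(Sˣ_x Sˣ_y))` for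
`H(Δ) = xxzHamiltonian 1 (torusGraph 2 L) (−1) Δ` (hard-core bosons with nearest-neighbour REPULSION `|Δ|`), and THEOREM Z⁺
(`groundState_unique_of_even`, `|Δ| < 1`, even `L`) identifies the tracial ground state with the sector-`0` Perron state.  Hence:

* `hcb_planarFloor` — `∃ a > 0, ∃ M₀, ∀ even M ≥ M₀: a·M⁴ ≤ Σ_{x,y} Re ω₀(Sˣ_xSˣ_y)` (positive `liminf` ⇒ floor);
* `sum_sum_groundStateXXZCorrTorus_zero`, `xxz_groundSpace_eq_span` (ground space of `H(Δ)` = the line of the sector-`0` Perron vector);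
* **`sectorAnchor_of_repulsive`** — for even `M ≥ M₀` every unit sector-`0` ground vector has `Re⟨ψ, S⁺_tot S⁻_tot ψ⟩ ≥ a·M⁴`
  (`(Sˣ_tot)² ≤ (Sˣ_tot)² + (Sʸ_tot)² = S⁺_tot S⁻_tot` on `Sᶻ_tot = 0`);
* **`halfFillingAnchor_of_repulsive : −0.15 ≤ Δ → Δ ≤ 0 → ∃ c₀ > 0, HalfFillingAnchor Δ c₀`** — (H1) DISCHARGED on the window;
* `condensateOnFirstSectors_repulsive_of_fidelityDefect` — with the tolerance form of T (any `Δ`): on the window, a tower-fidelity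
  defect `≤ δ ≤ δ₀(Δ, k)` on the first `k` links gives BEC at `N = L²/2 + j`, `j ≤ k`, with NO anchor hypothesis.

(The gap-form descendants of T are typed for `0 ≤ Δ < 1`; their proofs use `0 ≤ Δ` only through `|Δ| < 1`, so re-keying them to
`−1 < Δ < 1` and feeding this anchor is mechanical — left to a successor.)  All folklore-level plumbing on landed theorems.
-/

set_option linter.dupNamespace false
set_option autoImplicit false

noncomputable section

open Finset Filter Topology Matrix Complex
open Literature.MathematicalPhysics.QuantumLattice Literature.Probability.LatticeModels
open Summit.HubbardSuperconductivity.HubbardSuperconductivity.Theorems.AnisotropyChord.InsertionEntropy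
open Summit.HubbardSuperconductivity.HubbardSuperconductivity.Theorems.AnisotropyChord.Tower
open Summit.HubbardSuperconductivity.HubbardSuperconductivity.Theorems.AnisotropyChord

namespace Summit.HubbardSuperconductivity.HubbardSuperconductivity.Theorems.AnisotropyChord.Transfer

/-! ## The planar order parameter of `H(Δ)` as a ground-state expectation -/

/-- `Σ_{x,y} Re ω₀(Sˣ_x Sˣ_y) = Re ω₀((Sˣ_tot)²)` for the tracial ground state of `H(Δ)`. [folklore] -/
theorem sum_sum_groundStateXXZCorrTorus_zero (L : ℕ) [NeZero L] (Δ : ℝ) :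
    ∑ x : TorusSite 2 L, ∑ y : TorusSite 2 L, groundStateXXZCorrTorus 0 (d := 2) L 1 (-1) Δ x y =
      ((xxzHamiltonian 1 (torusGraph 2 L) (-1) Δ).groundStateFunctional (totalSpin 1 0 * totalSpin 1 0)).re := by
  rw [totalSpin, sum_mul_sum, map_sum, re_sum]
  refine sum_congr rfl fun x _ => ?_
  rw [map_sum, re_sum]
  exact sum_congr rfl fun y _ => groundStateXXZCorrTorus_of_neZero 0 L 1 (-1) Δ x y

/-- `0 ≤ Σ_{x,y} Re ω₀(Sˣ_x Sˣ_y)`. [folklore] -/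
theorem sum_sum_groundStateXXZCorrTorus_zero_nonneg (L : ℕ) [NeZero L] (Δ : ℝ) :
    0 ≤ ∑ x : TorusSite 2 L, ∑ y : TorusSite 2 L, groundStateXXZCorrTorus 0 (d := 2) L 1 (-1) Δ x y := by
  rw [sum_sum_groundStateXXZCorrTorus_zero]
  exact re_groundStateFunctional_mul_self_nonneg _ (totalSpin_isHermitian 1 0)

/-- **planar floor for repulsive hard-core bosons** (`−0.15 ≤ Δ ≤ 0`): `∃ a > 0, ∃ M₀, ∀ even M ≥ M₀: a·M⁴ ≤ Σ_{x,y} Re ω₀(Sˣ_xSˣ_y)` —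
the positive `liminf` of the tree's `hardCoreBoson_ground_planar_spinHalf_x` read as a floor (as `kls_planarFloor`).
[cite: KuboKishi1988] [cite: WischmannMullerhartmann1991, Abstract (p. 647)] -/
theorem hcb_planarFloor (Δ : ℝ) (hΔ : -0.15 ≤ Δ) (hΔ' : Δ ≤ 0) :
    ∃ a : ℝ, 0 < a ∧ ∃ M₀ : ℕ, ∀ (M : ℕ) [NeZero M], Even M → M₀ ≤ M →
      a * (M : ℝ) ^ 4 ≤
        ∑ x : TorusSite 2 M, ∑ y : TorusSite 2 M, groundStateXXZCorrTorus 0 (d := 2) M 1 (-1) Δ x y := by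
  have hLRO := hardCoreBoson_ground_planar_spinHalf_x Δ hΔ hΔ'
  unfold HasEvenTorusLRO HasLongRangeOrder at hLRO
  rw [← Filter.liminf_nat_add _ 1] at hLRO
  have key : ∀ k : ℕ,
      (∑ x ∈ halfOpenBox 2 (2 * (k + 1)), ∑ y ∈ halfOpenBox 2 (2 * (k + 1)),
          torusPullback (fun L x y => groundStateXXZCorrTorus 0 (d := 2) L 1 (-1) Δ x y) (2 * (k + 1)) x y) /
        ((halfOpenBox 2 (2 * (k + 1))).card : ℝ) ^ 2 =
      (∑ x : TorusSite 2 (2 * k + 1 + 1), ∑ y : TorusSite 2 (2 * k + 1 + 1),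
          groundStateXXZCorrTorus 0 (d := 2) (2 * k + 1 + 1) 1 (-1) Δ x y) /
        (((2 * k + 1 + 1 : ℕ) : ℝ) ^ 2) ^ 2 := by
    intro k
    rw [show 2 * (k + 1) = 2 * k + 1 + 1 by ring, XYOrderProofs.sum_halfOpenBox_torusPullback,
      card_halfOpenBox, Nat.cast_pow]
  simp only [key] at hLRO
  have hnn : ∀ k : ℕ, 0 ≤ (∑ x : TorusSite 2 (2 * k + 1 + 1), ∑ y : TorusSite 2 (2 * k + 1 + 1),
      groundStateXXZCorrTorus 0 (d := 2) (2 * k + 1 + 1) 1 (-1) Δ x y) /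
        (((2 * k + 1 + 1 : ℕ) : ℝ) ^ 2) ^ 2 :=
    fun k => div_nonneg (sum_sum_groundStateXXZCorrTorus_zero_nonneg _ Δ) (by positivity)
  obtain ⟨a, ha0, hal⟩ := exists_between hLRO
  have hev := Filter.eventually_lt_of_lt_liminf hal (isBoundedUnder_of ⟨0, hnn⟩)
  obtain ⟨K₀, hK₀⟩ := Filter.eventually_atTop.1 hev
  refine ⟨a, ha0, 2 * K₀ + 2, fun M _ hMeven hM => ?_⟩
  obtain ⟨j, hj⟩ := hMeven
  obtain ⟨k, rfl⟩ : ∃ k, M = 2 * k + 1 + 1 := ⟨j - 1, by omega⟩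
  have hk : K₀ ≤ k := by omega
  have h := hK₀ k hk
  rw [lt_div_iff₀ (by positivity)] at h
  have h4 : (((2 * k + 1 + 1 : ℕ) : ℝ) ^ 2) ^ 2 = ((2 * k + 1 + 1 : ℕ) : ℝ) ^ 4 := by ring
  rw [h4] at h
  exact h.le

/-! ## The ground space of `H(Δ)` is the line of the sector-`0` Perron vector (`|Δ| < 1`, even `L`) -/

/-- for even `L` and `|Δ| < 1` the ground space of `H(Δ)` is `ℂ ∙ a₀`, `a₀` the sector-`0` Perron amplitude, and `E(0)` is the ground
energy (THEOREM Z⁺, tree `groundState_unique_of_even`). [folklore: Mattis 1979, Nishimori 1981] -/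
theorem xxz_groundSpace_eq_span (L : ℕ) [NeZero L] (hL : Even L) {Δ : ℝ} (hΔ : |Δ| < 1)
    {a₀ : TensorIndex (TorusSite 2 L) 2 → ℝ} (ha₀ : IsPerronSectorGroundAmplitude L Δ 0 a₀) :
    (xxzHamiltonian 1 (torusGraph 2 L) (-1) Δ).groundSpace = ℂ ∙ (fun σ => (a₀ σ : ℂ)) ∧
      sectorE L Δ 0 = (xxzHamiltonian 1 (torusGraph 2 L) (-1) Δ).groundEnergy := by
  set H : Op (TorusSite 2 L) 2 := xxzHamiltonian 1 (torusGraph 2 L) (-1) Δ with hHdef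
  have hH : H.IsHermitian := xxzHamiltonian_isHermitian 1 (torusGraph 2 L) (-1) Δ
  haveI : Nonempty (TensorIndex (TorusSite 2 L) 2) := ⟨fun _ => 0⟩
  obtain ⟨hE, huniq⟩ := groundState_unique_of_even (L := L) hL hΔ ha₀
  have hEg : sectorE L Δ 0 = H.groundEnergy := by rw [hE, minEnergyOn_top_holds hH]
  refine ⟨le_antisymm ?_ ?_, hEg⟩
  · intro v hvG
    have hHv : H *ᵥ v = ((sectorE L Δ 0 : ℝ) : ℂ) • v := by rw [hEg]; exact (mem_groundSpace_iff H v).1 hvG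
    obtain ⟨c, hc⟩ := huniq v hHv
    exact Submodule.mem_span_singleton.2 ⟨c, hc.symm⟩
  · rw [Submodule.span_singleton_le_iff_mem, mem_groundSpace_iff, ← hEg]
    have := ha₀.eigen
    unfold sectorE ham
    exact this

/-! ## The anchor -/

/-- **THE SECTOR ANCHOR ON THE REPULSIVE WINDOW:** for `−0.15 ≤ Δ ≤ 0` there are `a > 0` and `M₀` such that for every even `M ≥ M₀`
every unit sector-`0` ground vector `ψ` of `H(Δ)` (`H ψ = E(0) ψ`) has `a·M⁴ ≤ Re⟨ψ, S⁺_tot S⁻_tot ψ⟩` — planar LRO of the tracial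
ground state (`hcb_planarFloor`), `ω₀ = ⟨ψ, ·ψ⟩` by Z⁺ uniqueness, `(Sˣ_tot)² ≤ (Sˣ_tot)² + (Sʸ_tot)² = S⁺_totS⁻_tot` on `Sᶻ_tot = 0`.
[cite: KuboKishi1988] [cite: WischmannMullerhartmann1991, Abstract (p. 647)] -/
theorem sectorAnchor_of_repulsive (Δ : ℝ) (hΔ : -0.15 ≤ Δ) (hΔ' : Δ ≤ 0) :
    ∃ a : ℝ, 0 < a ∧ ∃ M₀ : ℕ, ∀ (M : ℕ) [NeZero M], Even M → M₀ ≤ M →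
      ∀ ψ : TensorIndex (TorusSite 2 M) 2 → ℂ, ψ ∈ spinZSector (Λ := TorusSite 2 M) 1 0 → star ψ ⬝ᵥ ψ = 1 →
        xxzHamiltonian 1 (torusGraph 2 M) (-1) Δ *ᵥ ψ
            = ((lowestEnergyInSector 1 (xxzHamiltonian 1 (torusGraph 2 M) (-1) Δ) 0 : ℝ) : ℂ) • ψ →
          a * (M : ℝ) ^ 4 ≤ (star ψ ⬝ᵥ
            (((∑ x : TorusSite 2 M, onSite x (spinRaise 1)) * (∑ y : TorusSite 2 M, onSite y (spinLower 1))
              : Op (TorusSite 2 M) 2) *ᵥ ψ)).re := by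
  have hΔ1 : |Δ| < 1 := abs_lt.2 ⟨by norm_num at hΔ ⊢; linarith, by linarith⟩
  obtain ⟨a, ha, M₀, hfloor⟩ := hcb_planarFloor Δ hΔ hΔ'
  refine ⟨a, ha, M₀, fun M _ hM hM₀ ψ hψK hψ1 hHψ => ?_⟩
  set H : Op (TorusSite 2 M) 2 := xxzHamiltonian 1 (torusGraph 2 M) (-1) Δ with hHdef
  -- the sector-0 Perron amplitude and the ground space
  obtain ⟨a₀, ha₀⟩ := exists_perron_zero_of_even (L := M) Δ hM
  obtain ⟨hspan, hEsec⟩ := xxz_groundSpace_eq_span M hM hΔ1 ha₀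
  have hψG : ψ ∈ H.groundSpace := by
    rw [mem_groundSpace_iff, ← hEsec]; exact hHψ
  have hψ0 : ψ ≠ 0 := fun h => by
    rw [h, dotProduct_zero] at hψ1
    exact zero_ne_one hψ1
  have ha₀0 : (fun σ => (a₀ σ : ℂ)) ≠ 0 := by
    intro h0
    have : ∑ σ, a₀ σ ^ 2 = 0 := Finset.sum_eq_zero fun σ _ => by
      have := congrFun h0 σ
      simp only [Pi.zero_apply, Complex.ofReal_eq_zero] at this
      rw [this]; ring
    rw [ha₀.unit] at this; exact one_ne_zero this
  have hU : H.HasUniqueGroundState := by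
    change Module.finrank ℂ H.groundSpace = 1
    rw [hspan]
    exact finrank_span_singleton ha₀0
  have hω : ∀ O : Op (TorusSite 2 M) 2, H.groundStateFunctional O = star ψ ⬝ᵥ O *ᵥ ψ := fun O => by
    rw [groundStateFunctional_eq_of_hasUniqueGroundState hU hψG hψ0, hψ1, div_one]
  -- the floor: a M⁴ ≤ Re ω₀((Sˣ_tot)²) ≤ Re ω₀((Sˣ_tot)² + (Sʸ_tot)²) = Re⟨ψ, S⁺_tot S⁻_tot ψ⟩
  have hfl := hfloor M hM hM₀
  rw [sum_sum_groundStateXXZCorrTorus_zero] at hfl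
  have hy : 0 ≤ (H.groundStateFunctional (totalSpin 1 1 * totalSpin 1 1)).re :=
    re_groundStateFunctional_mul_self_nonneg _ (totalSpin_isHermitian 1 1)
  have hsum : (H.groundStateFunctional (totalSpin 1 0 * totalSpin 1 0)).re
      + (H.groundStateFunctional (totalSpin 1 1 * totalSpin 1 1)).re
      = (star ψ ⬝ᵥ ((raiseOn 1 Finset.univ * lowerOn 1 Finset.univ : Op (TorusSite 2 M) 2) *ᵥ ψ)).re := by
    rw [← Complex.add_re, ← map_add, hω, raiseOn_mul_lowerOn_mulVec_of_mem_zero 1 hψK]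
  have key : a * (M : ℝ) ^ 4
      ≤ (star ψ ⬝ᵥ ((raiseOn 1 Finset.univ * lowerOn 1 Finset.univ : Op (TorusSite 2 M) 2) *ᵥ ψ)).re := by
    rw [← hsum]; linarith
  exact key

/-- **(H1) DISCHARGED ON THE REPULSIVE WINDOW:** for `−0.15 ≤ Δ ≤ 0` there is `c₀ > 0` with `HalfFillingAnchor Δ c₀` — eventually in
`L`, every Perron amplitude of the half-filled sector of `H(Δ)` (hard-core bosons with nearest-neighbour repulsion `|Δ| ≤ 0.15`) has
condensate density `≥ c₀`.  (Odd `L`: no such amplitude, vacuous.) [cite: KuboKishi1988] [cite: WischmannMullerhartmann1991, Abstract (p. 647)] -/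
theorem halfFillingAnchor_of_repulsive (Δ : ℝ) (hΔ : -0.15 ≤ Δ) (hΔ' : Δ ≤ 0) : ∃ c₀ > (0 : ℝ), HalfFillingAnchor Δ c₀ := by
  obtain ⟨c, hc, M₀, hfloor⟩ := sectorAnchor_of_repulsive Δ hΔ hΔ'
  refine ⟨c, hc, ?_⟩
  unfold HalfFillingAnchor
  filter_upwards [eventually_ge_atTop M₀] with L hL
  intro _ a ha
  have hev : Even L := even_of_perron_zero L Δ a ha
  have hunit : star (Stiffness.toC L a) ⬝ᵥ Stiffness.toC L a = 1 := by
    unfold dotProduct Stiffness.toC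
    simp only [Pi.star_apply, RCLike.star_def, Complex.conj_ofReal]
    rw [show (∑ σ, (a σ : ℂ) * (a σ : ℂ)) = (((∑ σ, a σ ^ 2 : ℝ)) : ℂ) by push_cast; simp [sq], ha.unit]
    simp
  have h := hfloor L hev hL (Stiffness.toC L a) ha.sector hunit ha.eigen
  rw [Stiffness.star_dotProduct_raiseLower_toC, Complex.ofReal_re] at h
  have hcard : (Fintype.card (TorusSite 2 L) : ℝ) = (L : ℝ) ^ 2 := by
    rw [Fintype.card_fun, ZMod.card, Fintype.card_fin]; push_cast; ring
  have hL0 : (0 : ℝ) < (L : ℝ) := by exact_mod_cast Nat.pos_of_ne_zero (NeZero.ne L)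
  unfold condensateDensity
  rw [hcard, le_div_iff₀ (by positivity)]
  calc c * ((L : ℝ) ^ 2) ^ 2 = c * (L : ℝ) ^ 4 := by ring
    _ ≤ lowerNormSq a := h

/-- **BEC TRANSFER ON THE REPULSIVE WINDOW, NO ANCHOR HYPOTHESIS (tolerance currency):** for `−0.15 ≤ Δ ≤ 0` and every `k` there is
`δ₀ > 0` such that a tower-fidelity defect `≤ δ ≤ δ₀` on the first `k` links gives `CondensateOnFirstSectors Δ k` (BEC of hard-core
bosons with nearest-neighbour repulsion at `N = L²/2 + j`, `j ≤ k`). Anchor = `halfFillingAnchor_of_repulsive`, transfer =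
`condensateOnFirstSectors_of_fidelityDefect`. [folklore] -/
theorem condensateOnFirstSectors_repulsive_of_fidelityDefect (Δ : ℝ) (hΔ : -0.15 ≤ Δ) (hΔ' : Δ ≤ 0) (k : ℕ) :
    ∃ δ₀ > (0 : ℝ), ∀ δ : ℝ, 0 ≤ δ → δ ≤ δ₀ → TowerFidelityDefect Δ δ k → CondensateOnFirstSectors Δ k := by
  obtain ⟨c₀, hc₀, hA⟩ := halfFillingAnchor_of_repulsive Δ hΔ hΔ'
  have hk1 : (0 : ℝ) < (k : ℝ) + 1 := by positivity
  refine ⟨min (c₀ / ((k : ℝ) + 1)) (1 / 2), lt_min (by positivity) (by norm_num), fun δ hδ0 hδ hT => ?_⟩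
  have h1 : δ ≤ c₀ / ((k : ℝ) + 1) := le_trans hδ (min_le_left _ _)
  have h2 : δ ≤ 1 / 2 := le_trans hδ (min_le_right _ _)
  refine condensateOnFirstSectors_of_fidelityDefect hc₀ hδ0 (by linarith) ?_ hA hT
  have h3 : (k : ℝ) * (c₀ / ((k : ℝ) + 1)) < c₀ := by
    rw [mul_div_assoc', div_lt_iff₀ hk1]; nlinarith
  have hk0 : (0 : ℝ) ≤ k := Nat.cast_nonneg _
  nlinarith

end Summit.HubbardSuperconductivity.HubbardSuperconductivity.Theorems.AnisotropyChord.Transfer
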